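import Summits.QuantumFields.BalabanUV.T4Continuum.Support.B13StepTermLabels
import Summits.QuantumFields.BalabanUV.T4Continuum.Support.B13StepTermFamily

/-!
# NE5 ∕ U3, crux O1, row O1-d — the BRIDGE between part d1's term labels (`B13StepTermLabels`, leaf-02) and part d2's term
# family socket (`B13StepTermFamily.TermIndexing`, leaf-08): the labels INSTANTIATE the socket; (2.13)∘(2.9) by levels

Cell `pub-balaban`, unit `b2b-balaban-t4-ne5-formalise-leaf-02` (NE5 formalisation swarm, leaf prover 02; row O1-d1 of
`t4/b2b-balaban-t4-ne5-p1/O1-CLAIM-TABLE-NE5-P1.md`; journal l.5367 CLAIM, l.5667 the agreed fit with leaf-08).  Summits-side NEW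
WORK under the LEAN PLACEMENT RULE (bookkeeping; nothing of the manuscripts under audit is asserted; [Balaban1988RG2Cluster] is cited
for KIND∕locus only).  HONEST FRAMING: rung (B)+1 bookkeeping for the FINITE-VOLUME T⁴ programme — NOT the continuum limit by itself,
NOT infinite volume, NOT a mass gap, NOT Clay; NE5 NOT PROVED; spine 0∕9.  HONEST DEPENDENCY (cell line, verbatim): continuum YM on
T⁴ ⇐ BetaPertH ∧ nine spine estimates (0/9 proved); BetaPertH ⇐ (D1) ∧ (D4) ∧ CAP+tail; G-an2-4 gates asym, D1 and NE2/3/4.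

WHAT THIS FILE DOES (both imports BY NAME; no estimate anywhere).
* §1 `touchInc G` — the hard core on polymers ((2.11) p. 14 *"ζ(Z, Z′) = 0 if Z ∩ Z′ contains a cube, or a wall of a cube"*) =
  the geometry's `touch` on footprints; `labelsIndexing G D : TermIndexing C (TermIdx C.Dom Bnd) C.Dom (InnerLabel C.Dom Bnd)` —
  THE INSTANCE of leaf-08's socket on leaf-02's labels (`len t = n`, `poly t = t.polys`, `lab t m = (t.2 m).inner`,
  `Rel k t X ⟺ C.scale X = k ∧ t.LocalizesAt G D k X`); `rhoT_eq` (the two files' `ρᵀ` are the SAME term, `rfl`), `coeff_eq`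
  (`((n+1)!)⁻¹·ρᵀ = ↑(ρᵀ/(n+1)!)`), `term_eq_zero_of_not_localizesAt` (the support hypothesis every consumer wants).
* §2 `unzip : TermIdx C.Dom Bnd ≃ TermIndexing.CanonIdx C (InnerLabel C.Dom Bnd)` and `rel_iff_canonical`: the instance IS
  leaf-08's reference indexing `canonical G (fun Z => innerLabels D (C.scale Z) Z)` read through the unzip (no second index
  convention in the cell).
* §3 (2.13)∘(2.9) BY LEVELS for the socket's terms: `sum_term_termLabels` — at a step-`k` domain `X`,
  `Σ_{t ∈ termLabels k X n} term k ⟨n, t⟩ o h X = Σ_{Z ∈ polyTuples k X n} ((n+1)!)⁻¹ρᵀ(Z) · Π_m H(Z m)` with the ACTIVITY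
  `H Z := Σ_{ℓ ∈ innerLabels k Z} act Z ℓ o h` (the printed shape: (2.13) p. 14 over tuples, each `H(Z)` the sum (2.9)∕(2.1)∕(2.3)
  of its resummed terms); `hasSum_term_of_levelwise`∕`out_eq_levelwise` — if the level sums of `‖term‖` are summable in `n`
  then the family HAS the sum `Σ' n Σ_{t ∈ termLabels}` and leaf-08's `out` equals it.
* §4 `termRep_lift_term` — leaf-02's anchored re-coding (`B13StepTermLabels.Coding`, the remedy for the X-blind budget, journal
  l.5621) applied to the socket's family: `TermRep M K (term …) W → TermRep M K (κ.lift (term …)) W`.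
0 sorry; axioms ⊆ {propext, Classical.choice, Quot.sound}.
-/

namespace Summit.QuantumFields.BalabanUV.T4Continuum.B13StepTermSocket

open scoped BigOperators
open Literature.MathematicalPhysics.QuantumFieldTheory.Balaban1983to89.T4OutputRate (Carriers)
open Literature.MathematicalPhysics.QuantumFieldTheory.Balaban1983to89.T4InputCauchyRateData (StepModel)
open Literature.MathematicalPhysics.QuantumFieldTheory.Balaban1983to89.T4InputCauchyRateTermwise (TermRep)
open Summit.QuantumFields.BalabanUV.T4Continuum.ClusterRepOfDomains (DomainGeometry)
open Summit.QuantumFields.BalabanUV.T4Continuum.B13StepTermLabels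
open Summit.QuantumFields.BalabanUV.T4Continuum.B13StepTermFamily (TermIndexing term out term_of_not_rel term_of_rel)

variable {C : Carriers} [DecidableEq C.Dom] {Cube : Type*} [DecidableEq Cube] {Bnd : Type*} [DecidableEq Bnd]
  (G : DomainGeometry C Cube) (D : InnerData C Bnd)

/-! ## §1 The instance of the socket on the labels -/

/-- [folklore] The hard core on polymers: footprints touch ((2.11)'s `ζ = 0`; route P2's `DomainGeometry.touch`). -/
def touchInc : C.Dom → C.Dom → Prop := fun Z Z' => G.touch (G.cubes Z) (G.cubes Z')

/-- [folklore] The hard core is decidable. -/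
instance decTouchInc : DecidableRel (touchInc G) := fun _ _ => G.decTouch _ _

/-- [folklore] **THE INSTANCE** of leaf-08's `TermIndexing` socket on leaf-02's term labels: a label localizes at `X` at step
`k` iff `X` is a step-`k` domain and the label `LocalizesAt G D k X`. -/
def labelsIndexing : TermIndexing C (TermIdx C.Dom Bnd) C.Dom (InnerLabel C.Dom Bnd) where
  len t := t.1
  poly t := t.polys
  lab t m := (t.2 m).inner
  Rel k t X := C.scale X = k ∧ t.LocalizesAt G D k X
  decRel _ _ _ := by infer_instance

/-- [folklore] Unfolding the instance's localization relation. -/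
theorem rel_iff {k : ℕ} {t : TermIdx C.Dom Bnd} {X : C.Dom} :
    (labelsIndexing G D).Rel k t X ↔ C.scale X = k ∧ t.LocalizesAt G D k X := Iff.rfl

omit [DecidableEq Bnd] in
/-- [folklore] The two files' Ursell coefficients are the same term. -/
theorem rhoT_eq {n : ℕ} (Z : Fin (n + 1) → C.Dom) : B13StepTermFamily.rhoT (touchInc G) Z = B13StepTermLabels.rhoT G Z := rfl

/-- [folklore] The two files' coefficients agree (`((n+1)!)⁻¹·ρᵀ = ↑(ρᵀ/(n+1)!)`). -/
theorem coeff_eq (t : TermIdx C.Dom Bnd) :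
    B13StepTermFamily.coeff (labelsIndexing G D) (touchInc G) t = ((B13StepTermLabels.coeff G t : ℝ) : ℂ) := by
  unfold B13StepTermFamily.coeff B13StepTermLabels.coeff
  rw [Complex.ofReal_div, Complex.ofReal_intCast, Complex.ofReal_natCast, div_eq_inv_mul]
  rfl

/-- [folklore] THE SUPPORT HYPOTHESIS: the socket's term family on these labels vanishes off the labels localizing at `X`. -/
theorem term_eq_zero_of_not_localizesAt {Op Hist : Type*} (act : C.Dom → InnerLabel C.Dom Bnd → Op → Hist → ℂ) {k : ℕ}
    {X : C.Dom} (t : TermIdx C.Dom Bnd) (ht : ¬ t.LocalizesAt G D k X) (o : Op) (h : Hist) :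
    term (labelsIndexing G D) (touchInc G) act k t o h X = 0 :=
  term_of_not_rel (labelsIndexing G D) (touchInc G) act (fun hR => ht ((rel_iff G D).1 hR).2) o h

/-! ## §2 The instance is the reference indexing, unzipped -/

/-- [folklore] Unzipping a tuple of factor labels into (tuple of polymers, tuple of inner labels). -/
def unzip : TermIdx C.Dom Bnd ≃ TermIndexing.CanonIdx C (InnerLabel C.Dom Bnd) where
  toFun t := ⟨t.1, (fun m => (t.2 m).Z, fun m => (t.2 m).inner)⟩
  invFun i := ⟨i.1, fun m => ⟨i.2.1 m, i.2.2 m⟩⟩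
  left_inv _ := rfl
  right_inv _ := rfl

/-- [folklore] **ONE INDEX CONVENTION**: the instance's relation is leaf-08's `canonical` relation (label catalogue
`Z ↦ innerLabels D (scale Z) Z`) read through `unzip`. -/
theorem rel_iff_canonical (k : ℕ) (t : TermIdx C.Dom Bnd) (X : C.Dom) :
    (labelsIndexing G D).Rel k t X ↔
      (TermIndexing.canonical G (fun Z => innerLabels D (C.scale Z) Z)).Rel k (unzip t) X := by
  rw [rel_iff, TermIndexing.canonical_rel_iff]
  change _ ↔ C.scale X = k ∧ (∀ m, C.scale ((t.2 m).Z) = k) ∧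
    (Finset.univ.biUnion fun m => G.cubes ((t.2 m).Z)) = G.cubes X ∧ ∀ m, (t.2 m).inner ∈ innerLabels D (C.scale (t.2 m).Z) (t.2 m).Z
  constructor
  · rintro ⟨hX, hwf, hcov⟩
    refine ⟨hX, fun m => (G.mem_level _ _).1 (hwf m).1, hcov, fun m => ?_⟩
    rw [(G.mem_level _ _).1 (hwf m).1]
    exact (mem_innerLabels D).2 (hwf m).2.2
  · rintro ⟨hX, hsc, hcov, hlab⟩
    refine ⟨hX, fun m => ⟨(G.mem_level _ _).2 (hsc m), ?_, ?_⟩, hcov⟩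
    · rw [← hcov]
      exact Finset.subset_biUnion_of_mem (fun m => G.cubes ((t.2 m).Z)) (Finset.mem_univ m)
    · have h := hlab m
      rw [hsc m] at h
      exact (mem_innerLabels D).1 h

/-! ## §3 (2.13)∘(2.9) by levels for the socket's terms -/

/-- [folklore] **THE LEVEL-`n` SLICE OF (2.13)∘(2.9)** for the socket's term family: at a step-`k` domain `X`, the sum of the
terms with `n + 1` factors localizing at `X` is the sum over the covering polymer tuples of `((n+1)!)⁻¹ρᵀ(Z)` times the product
of the ACTIVITIES `H(Z m) = Σ_{ℓ ∈ innerLabels k (Z m)} act (Z m) ℓ o h`. -/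
theorem sum_term_termLabels {Op Hist : Type*} (act : C.Dom → InnerLabel C.Dom Bnd → Op → Hist → ℂ) {k : ℕ} {X : C.Dom}
    (hX : C.scale X = k) (n : ℕ) (o : Op) (h : Hist) :
    ∑ t ∈ termLabels G D k X n, term (labelsIndexing G D) (touchInc G) act k ⟨n, t⟩ o h X =
      ∑ Z ∈ polyTuples G k X n, ((Nat.factorial (n + 1) : ℂ))⁻¹ * (B13StepTermLabels.rhoT G Z : ℂ) *
        ∏ m, ∑ ℓ ∈ innerLabels D k (Z m), act (Z m) ℓ o h := by
  rw [← sum_termLabels_eq_sum_polyTuples G D k X n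
    (fun Z => ((Nat.factorial (n + 1) : ℂ))⁻¹ * (B13StepTermLabels.rhoT G Z : ℂ)) (fun p => act p.Z p.inner o h)]
  refine Finset.sum_congr rfl fun t ht => ?_
  rw [term_of_rel (labelsIndexing G D) (touchInc G) act ((rel_iff G D).2 ⟨hX, (mem_termLabels G D).1 ht⟩) o h]
  rfl

/-- [folklore] **`HasSum` BY LEVELS** for the socket's terms: if the level sums of norms are summable in `n`, the family has
the sum `Σ' n Σ_{t ∈ termLabels k X n}`. -/
theorem hasSum_term_of_levelwise {Op Hist : Type*} (act : C.Dom → InnerLabel C.Dom Bnd → Op → Hist → ℂ) {k : ℕ} {X : C.Dom}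
    (o : Op) (h : Hist)
    (hsum : Summable fun n => ∑ t ∈ termLabels G D k X n, ‖term (labelsIndexing G D) (touchInc G) act k ⟨n, t⟩ o h X‖) :
    HasSum (fun t => term (labelsIndexing G D) (touchInc G) act k t o h X)
      (∑' n, ∑ t ∈ termLabels G D k X n, term (labelsIndexing G D) (touchInc G) act k ⟨n, t⟩ o h X) :=
  hasSum_of_levelwise G D k X (fun t ht => term_eq_zero_of_not_localizesAt G D act t ht o h) hsum

/-- [folklore] Under the same summability leaf-08's `out` IS the level series. -/
theorem out_eq_levelwise {Op Hist : Type*} (act : C.Dom → InnerLabel C.Dom Bnd → Op → Hist → ℂ) {k : ℕ} {X : C.Dom}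
    (o : Op) (h : Hist)
    (hsum : Summable fun n => ∑ t ∈ termLabels G D k X n, ‖term (labelsIndexing G D) (touchInc G) act k ⟨n, t⟩ o h X‖) :
    out (labelsIndexing G D) (touchInc G) act k o h X =
      ∑' n, ∑ t ∈ termLabels G D k X n, term (labelsIndexing G D) (touchInc G) act k ⟨n, t⟩ o h X :=
  (hasSum_term_of_levelwise G D act o h hsum).tsum_eq

/-! ## §4 The anchored re-coding applied to the socket's family -/

/-- [folklore] `TermRep` for the socket's family transfers along ANY anchored coding of the labels (leaf-02's remedy for the
X-blind budget of the termwise interface). -/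
theorem termRep_lift_term {Op Hist : Type*} [NormedAddCommGroup Op] [NormedSpace ℂ Op] [NormedAddCommGroup Hist]
    [NormedSpace ℂ Hist] {ι₀ : Type*} (κ : Coding G D ι₀) (act : C.Dom → InnerLabel C.Dom Bnd → Op → Hist → ℂ)
    (M : StepModel C Op Hist) (K : ℕ → (ℕ → ℝ) → C.BgB → Set (Op × Hist)) {W : Set (ℕ → ℝ)}
    (hrep : TermRep M K (term (labelsIndexing G D) (touchInc G) act) W) :
    TermRep M K (κ.lift (term (labelsIndexing G D) (touchInc G) act)) W :=
  κ.termRep_lift M K _ (fun _ _ o h t ht => term_eq_zero_of_not_localizesAt G D act t ht o h) hrep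

end Summit.QuantumFields.BalabanUV.T4Continuum.B13StepTermSocket
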